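import Literature.Probability.RandomPlanarGeometry.HexSAWStripWidthTwoContactCLT
import Literature.Probability.Distributions.PolyaUniformCdfConvergence
import HarnessLib

/-!
# The width-two strip at criticality: the central limit theorem for the surface contacts holds UNIFORMLY in `x` — the Kolmogorov distance
# to the Gaussian tends to zero (module «WIDTH-TWO CONTACT KOLMOGOROV»; corollary of «WIDTH-TWO CONTACT CLT» via Pólya's theorem)

Topic `Literature/Probability/RandomPlanarGeometry` (continues «WIDTH-TWO CONTACT CLT» `HexSAWStripWidthTwoContactCLT.lean` — `W2.contactLawStepTwo`, `W2.contactLawTwo`,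
`W2.tendsto_contactLawStepTwo`, `W2.tendsto_contactLawTwo` (weak convergence to `N(0, σ₂²)` / `N(0, σ̂)`), `W2.contactLawStepTwo_real_Iic`, `W2.varRateHat_pos`,
`W2.limTwo_pos`, `W2.tendsto_hatD_two` — with the tree's Pólya theorem `Literature.Probability.Distributions.Durrett2019_exercise_3_2_9` (R. Durrett, *Probability:
Theory and Examples* (2019) §3.2 Exercise 3.2.9; E. L. Lehmann, *Elements of Large-Sample Theory* (1999) §2.6 Theorem 2.6.1 p. 85 — G. Pólya 1920: weak convergence
to a law with a continuous distribution function is uniform convergence of the distribution functions) and Mathlib's `nullSingletonClass_gaussianReal`,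
`StieltjesFunction.measure_singleton`, `cdf_eq_real`).  Lane «pcv-sawmu» (CriticalPhenomena venture), a-p2 g27.  Nothing below is printed.

## What is proved (namespace `…SAW.HV.W2`; `θ₂ = (3 − √2)/4`, `σ₂² = (96 − 67√2)/8`, `σ̂ = (96 − 67√2)/4`, `n = hatLen (k+1) a b`, `y₂ = stripYT 2`)
* ★★ `tendstoUniformly_cdf_contactLawStepTwo (a b)` — `cdf(law of (#top − θ₂n)/√n under the critical weights on the bridges a → b of hat index k+1) → cdf N(0, σ₂²)`
  UNIFORMLY on `ℝ` (`TendstoUniformly`, `k → ∞`); ★★ `tendstoUniformly_cdf_contactLawTwo (a b)` — the same in the hat normalisation `(#top − φ₃(k+1))/√(k+1)`, limit `N(0, σ̂)`.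
* ★★★ **`widthTwo_contacts_kolmogorov (a b) (hε : 0 < ε)`** — for all large `k` and ALL `x ∈ ℝ` at once,
  `|(Σ_{bridges a→b of hat index k+1, #top ≤ θ₂n + x√n} x_c^{n} y₂^{#top}) / D̂(k+1; y₂)_{ab} − N(0, σ₂²)(−∞, x]| < ε`: the explicit-sum central limit theorem of
  «WIDTH-TWO CONTACT CLT» (`tendsto_contactCDFStepTwo`, pointwise in `x`) holds uniformly in `x`.
(Private: `continuous_cdf_gaussianReal_W2`, continuity of a non-degenerate Gaussian distribution function by the Stieltjes-jump argument.)

Label: LANE THEOREM (own result of lane «pcv-sawmu», a-p2 g27, 2026-08-28; not in print).  NOT claimed: a RATE for the Kolmogorov distance (Berry–Esseen type),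
a local limit theorem, `T ≥ 3`.
-/

noncomputable section

open Finset Filter Topology Matrix MeasureTheory ProbabilityTheory Literature.Probability.LatticeModels Literature.Probability.Percolation Literature.Analysis

namespace Literature.Probability.RandomPlanarGeometry.SAW

namespace HV

namespace W2

/-! ## The convergence of the distribution functions is UNIFORM in `x` (Pólya's theorem) -/

/-- The distribution function of a non-degenerate Gaussian law is continuous (no atoms: the jump of a Stieltjes function at `a` is the mass of `{a}`).
[folklore] -/
private theorem continuous_cdf_gaussianReal_W2 {m : ℝ} {v : NNReal} (hv : v ≠ 0) : Continuous (cdf (gaussianReal m v)) := by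
  haveI := nullSingletonClass_gaussianReal (μ := m) (v := v) hv
  rw [continuous_iff_continuousAt]
  intro a
  rw [(monotone_cdf _).continuousAt_iff_leftLim_eq_rightLim, StieltjesFunction.rightLim_eq]
  have h1 : Function.leftLim (cdf (gaussianReal m v)) a ≤ cdf (gaussianReal m v) a := (monotone_cdf _).leftLim_le le_rfl
  have h2 : (cdf (gaussianReal m v)).measure {a} =
      ENNReal.ofReal (cdf (gaussianReal m v) a - Function.leftLim (cdf (gaussianReal m v)) a) :=
    StieltjesFunction.measure_singleton _ a
  rw [measure_cdf, measure_singleton a, eq_comm, ENNReal.ofReal_eq_zero] at h2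
  linarith

/-- ★★ **THE CENTRAL LIMIT THEOREM HOLDS UNIFORMLY IN `x` (Pólya)**: the distribution functions of `(#top − θ₂n)/√n` under the critical weights on the
bridges `a → b` of hat index `k+1` converge to the distribution function of `N(0, σ₂²)`, `σ₂² = (96 − 67√2)/8`, UNIFORMLY on `ℝ` — weak convergence
(«WIDTH-TWO CONTACT CLT» `tendsto_contactLawStepTwo`) to a law with a continuous distribution function is uniform convergence of distribution functions
(the tree's `Literature.Probability.Distributions.Durrett2019_exercise_3_2_9`).
[cite: Durrett2019, §3.2 Exercise 3.2.9; Lehmann1999, §2.6 Theorem 2.6.1 (Pólya) p. 85; lane «pcv-sawmu» a-p2 g27 — own result, not in print] -/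
theorem tendstoUniformly_cdf_contactLawStepTwo (a b : Fin (2 * 2)) :
    TendstoUniformly (fun k : ℕ => (cdf (contactLawStepTwo (k + 1) a b) : ℝ → ℝ))
      (cdf (gaussianReal 0 ((96 - 67 * Real.sqrt 2) / 8).toNNReal)) atTop := by
  have hσ : 0 < (96 - 67 * Real.sqrt 2) / 8 := by linarith [varRateHat_pos]
  have hv : ((96 - 67 * Real.sqrt 2) / 8).toNNReal ≠ 0 := by
    rw [ne_eq, Real.toNNReal_eq_zero, not_le]; exact hσ
  have h := Literature.Probability.Distributions.Durrett2019_exercise_3_2_9 (tendsto_contactLawStepTwo a b)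
    (by simpa only [ProbabilityMeasure.coe_mk] using continuous_cdf_gaussianReal_W2 (m := 0) hv)
  simpa only [ProbabilityMeasure.coe_mk] using h

/-- ★★ The same in the hat normalisation: the distribution functions of `(#top − φ₃(k+1))/√(k+1)` converge to that of `N(0, σ̂)`, `σ̂ = (96 − 67√2)/4`,
UNIFORMLY on `ℝ`. [cite: Durrett2019, §3.2 Exercise 3.2.9; Lehmann1999, §2.6 Theorem 2.6.1 p. 85; lane «pcv-sawmu» a-p2 g27 — own result] -/
theorem tendstoUniformly_cdf_contactLawTwo (a b : Fin (2 * 2)) :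
    TendstoUniformly (fun k : ℕ => (cdf (contactLawTwo (k + 1) a b) : ℝ → ℝ))
      (cdf (gaussianReal 0 ((96 - 67 * Real.sqrt 2) / 4).toNNReal)) atTop := by
  have hσ := varRateHat_pos
  have hv : ((96 - 67 * Real.sqrt 2) / 4).toNNReal ≠ 0 := by
    rw [ne_eq, Real.toNNReal_eq_zero, not_le]; exact hσ
  have h := Literature.Probability.Distributions.Durrett2019_exercise_3_2_9 (tendsto_contactLawTwo a b)
    (by simpa only [ProbabilityMeasure.coe_mk] using continuous_cdf_gaussianReal_W2 (m := 0) hv)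
  simpa only [ProbabilityMeasure.coe_mk] using h

/-- ★★★ **THE KOLMOGOROV DISTANCE TENDS TO ZERO**: for every `ε > 0`, for all large `k` and ALL `x ∈ ℝ` simultaneously,
`|(Σ_{bridges a→b of hat index k+1, n steps, #top ≤ θ₂n + x√n} x_c^{n} y₂^{#top}) / D̂(k+1; y₂)_{ab} − N(0, σ₂²)(−∞, x]| < ε` — the explicit-sum form of
`tendstoUniformly_cdf_contactLawStepTwo`, uniform in `x` where «WIDTH-TWO CONTACT CLT» `tendsto_contactCDFStepTwo` was pointwise.
[cite: Durrett2019, §3.2 Exercise 3.2.9; Feller1968, XIII.6; DuminilCopinHammond2013, §2.2; lane «pcv-sawmu» a-p2 g27 — own result, not in print] -/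
theorem widthTwo_contacts_kolmogorov (a b : Fin (2 * 2)) {ε : ℝ} (hε : 0 < ε) :
    ∀ᶠ k : ℕ in atTop, ∀ x : ℝ,
      |(∑ l ∈ (LUset 2 (2 * (k + 1) + 1) (hatLen (k + 1) a b) (a : ℕ) (b : ℕ)).filter
          (fun l => (topCnt 2 l.tail : ℝ) ≤ (3 - Real.sqrt 2) / 4 * ((hatLen (k + 1) a b : ℤ) : ℝ) + x * Real.sqrt ((hatLen (k + 1) a b : ℤ) : ℝ)),
          wD 2 (stripYT 2) l) / hatD 2 (stripYT 2) (k + 1) a b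
        - (gaussianReal 0 ((96 - 67 * Real.sqrt 2) / 8).toNNReal).real (Set.Iic x)| < ε := by
  have hA : 0 < limTwo a b := limTwo_pos a b
  have hev : ∀ᶠ k : ℕ in atTop, hatD 2 (stripYT 2) (k + 1) a b ≠ 0 :=
    ((tendsto_hatD_two a b).comp (tendsto_add_atTop_nat 1)).eventually_ne hA.ne'
  have hu := Metric.tendstoUniformly_iff.1 (tendstoUniformly_cdf_contactLawStepTwo a b) ε hε
  filter_upwards [hu, hev] with k hk hD x
  have h1 := hk x
  rw [Real.dist_eq, abs_sub_comm] at h1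
  haveI := isProbabilityMeasure_contactLawStepTwo (k + 1) a b
  rwa [cdf_eq_real, cdf_eq_real, contactLawStepTwo_real_Iic (by omega) hD x] at h1

end W2

end HV

end Literature.Probability.RandomPlanarGeometry.SAW
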